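import Summits.ValiantsHypothesis.ValiantsHypothesis.Theorems.KPlusLogSqLawTropicalBToeplitzCornerPin
import Summits.ValiantsHypothesis.ValiantsHypothesis.Theorems.KPlusLogSqLawTropicalBToeplitzCalibration
import Summits.ValiantsHypothesis.ValiantsHypothesis.Theorems.KPlusLogSqLawTropicalBToeplitzSectorLaw

/-!
# Route `KPlusLogSqLaw`, crux `TropicalB` — Toeplitz sector: the cell's CONJECTURE T, typed (names of record) with its kernel facts

HONEST FRAMING.  Helper / definition file toward the registered stubs `stub_tropThin` / `stub_tropFat` of
`Cruxes/TropicalB/Lines/birth.lean` (crux `Summit.ValiantsHypothesis.ValiantsHypothesis.Theses.KPlusLogSqLaw.TropicalB`,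
ledger item `stmt-ValiantsHypothesis-19771`, route `KPlusLogSqLaw`; cell `pub-symmetroid`, seat `val-sym-trop-p3`,
2026-08-26).  It NAMES the hypothesis of the tree's Toeplitz reduction `toeplitz_chain_le_of_linearBound` (p429098) and the
cell's OPEN Conjecture T about it, in the names adopted by the cell as its typed targets of record (method memo
CONJT-METHOD-g22 §5 / desk ruling R1501 (2); the sketches `ToeplitzSharpen_sketch.lean` of the method seat and
`ConjT_Statements_sketch.lean` of this seat's predecessor are reconciled here: the former's names survive, the latter's
`ToeplitzChainBound` / `ConjTLinear c` / `ConjTPoly c` are retired in favour of `LinearInstanceBound` / `ConjectureTLinear` /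
`ConjectureTPoly`), and restates BY NAME every kernel fact the lane has about them.  Every `Conjecture*` below is an OPEN
statement typed as a `Prop` — NOTHING here asserts any of them; nothing here bears on `TropicalB` for general designs, on
`WeakLifting`, `KPlusLogSqLaw`, `MatrixDescartes` or `VP ≠ VNP`.

CONTENTS.
* `LinearInstanceBound m Φ` («`Φ_Toep(m) ≤ Φ`»): every LINEAR Toeplitz instance — slopes `ψ`, intercepts `α` on the
  displacements, admissible displacement set `P` — has at most `Φ` pairwise distinct admissible permutations each the UNIQUE
  admissible maximiser of `Σ_b (θ'_k ψ + α)(τ b − b)` at strictly increasing integer slopes; verbatim the hypothesis `hΦ` of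
  `toeplitz_chain_le_of_linearBound` (`chain_le_of_linearInstanceBound`).  One-direction classes `FixedSlopeInstanceBound`,
  `ResidueSlopeInstanceBound`; the frameless sub-count `FramelessInstanceBound` (`Frameless τ`: no proper window `[a, a+ℓ)`
  mapped into itself).
* The conjectures (OPEN, `Prop`s): `ConjectureTLinear` (`∃ C, Φ_Toep(m) ≤ C·m`), `ConjectureTPoly` (`≤ (m+1)^C`, all the
  reduction needs), `ConjectureTSharp` (`≤ 5m`, the located constant: falsifiable by one instance), `ConjectureQ` (one fixed
  slope direction `ψ = δ²`), `ConjectureR` (wrap-blind slopes), `ConjectureT0` (frameless members `≤ C·m`); the obvious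
  implications `T♯ ⇒ T ⇒ {T_poly, Q, R, T⁰}`.
* KERNEL FACTS BY NAME: `cornerPinMonotone : CornerPinMonotone` and `frameEmbedding : FrameEmbedding` (monotonicity in the
  size, `…ToeplitzCornerPin`, this seat), `LinearInstanceBound.of_le`; the certified floors `18 / 23 / 26 / 28 ≤ Φ` at every
  `m ≥ 6 / 7 / 8 / 9` (`…ToeplitzSix/Seven/Eight/Nine` + monotonicity), `not_linearInstanceBound_nine_27`,
  `not_conjectureTLinear_three` / `four_le_of_conjectureTLinear` (`…ToeplitzCalibration`: any linear constant is `≥ 4`),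
  non-vacuity `LinearInstanceBound.one_le`, the sanity rows `linearInstanceBound_zero_iff` / `linearInstanceBound_one_iff`, and
  the lane's CONDITIONAL PAYOFF `toeplitzSector_of_conjectureTPoly` (`…ToeplitzSectorLaw`: polynomial Conjecture T ⇒ every
  Toeplitz design obeys the `K + log² m` law with `C = 9c + 13`).

References: folklore; the cited tree files.  No literature states Conjecture T (Toeplitz-cost parametric assignment; method
memo §8 nulls in both corpora).
-/

set_option linter.dupNamespace false
set_option autoImplicit false

namespace Summit.ValiantsHypothesis.ValiantsHypothesis.Theorems.KPlusLogSqLaw.Toeplitz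

open Summit.ValiantsHypothesis.ValiantsHypothesis.Theorems.KPlusLogSqLaw
open Summit.ValiantsHypothesis.ValiantsHypothesis.Theorems.MatrixDescartes.Negative
open scoped BigOperators
open Finset

/-! ## The count `Φ_Toep(m) ≤ Φ` and its one-direction classes -/

/-- **«`Φ_Toep(m) ≤ Φ`»** — the hypothesis of `toeplitz_chain_le_of_linearBound`, named: every LINEAR Toeplitz instance of size
`m` — slopes `ψ`, intercepts `α` on the displacements, admissible displacement set `P` — has at most `Φ` pairwise distinct
admissible permutations `τ₀ … τ_N` with `τ_k` the UNIQUE admissible maximiser of `Σ_b (θ'_k·ψ + α)(τ b − b)` at strictly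
increasing integer slopes `θ'`. -/
def LinearInstanceBound (m Φ : ℕ) : Prop :=
  ∀ (ψ α : ℤ → ℤ) (P : ℤ → Prop) (N : ℕ) (θ' : Fin (N + 1) → ℤ) (τ : Fin (N + 1) → Equiv.Perm (Fin m)),
    StrictMono θ' → Function.Injective τ → (∀ k b, P ((τ k b : ℤ) - (b : ℤ))) →
    (∀ k (σ' : Equiv.Perm (Fin m)), σ' ≠ τ k → (∀ b, P ((σ' b : ℤ) - (b : ℤ))) →
      ∑ b, (θ' k * ψ ((σ' b : ℤ) - (b : ℤ)) + α ((σ' b : ℤ) - (b : ℤ))) <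
        ∑ b, (θ' k * ψ ((τ k b : ℤ) - (b : ℤ)) + α ((τ k b : ℤ) - (b : ℤ)))) →
    N + 1 ≤ Φ

/-- The same count with the slope function `ψ` FIXED (intercepts `α` and admissible set `P` free). -/
def FixedSlopeInstanceBound (m : ℕ) (ψ : ℤ → ℤ) (Φ : ℕ) : Prop :=
  ∀ (α : ℤ → ℤ) (P : ℤ → Prop) (N : ℕ) (θ' : Fin (N + 1) → ℤ) (τ : Fin (N + 1) → Equiv.Perm (Fin m)),
    StrictMono θ' → Function.Injective τ → (∀ k b, P ((τ k b : ℤ) - (b : ℤ))) →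
    (∀ k (σ' : Equiv.Perm (Fin m)), σ' ≠ τ k → (∀ b, P ((σ' b : ℤ) - (b : ℤ))) →
      ∑ b, (θ' k * ψ ((σ' b : ℤ) - (b : ℤ)) + α ((σ' b : ℤ) - (b : ℤ))) <
        ∑ b, (θ' k * ψ ((τ k b : ℤ) - (b : ℤ)) + α ((τ k b : ℤ) - (b : ℤ)))) →
    N + 1 ≤ Φ

/-- The count over RESIDUE-CLASS slope functions (`ψ (δ + m) = ψ δ`: slopes blind to the wrap bit; intercepts free) — the
smallest natural class above the affine-wrap rung `toeplitz_affineWrap_chain_succ_le` (which needs BOTH `ψ` and `α`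
residue-affine). -/
def ResidueSlopeInstanceBound (m Φ : ℕ) : Prop :=
  ∀ ψ : ℤ → ℤ, (∀ δ : ℤ, ψ (δ + m) = ψ δ) → FixedSlopeInstanceBound m ψ Φ

/-- the full class is the conjunction of its one-direction classes. -/
theorem linearInstanceBound_iff_fixedSlope (m Φ : ℕ) :
    LinearInstanceBound m Φ ↔ ∀ ψ : ℤ → ℤ, FixedSlopeInstanceBound m ψ Φ :=
  ⟨fun h ψ α P N θ' τ hθ hτ hP hopt => h ψ α P N θ' τ hθ hτ hP hopt,
    fun h ψ α P N θ' τ hθ hτ hP hopt => h ψ α P N θ' τ hθ hτ hP hopt⟩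

/-- specialisation to one slope direction. -/
theorem fixedSlope_of_linear {m Φ : ℕ} (h : LinearInstanceBound m Φ) (ψ : ℤ → ℤ) :
    FixedSlopeInstanceBound m ψ Φ :=
  (linearInstanceBound_iff_fixedSlope m Φ).mp h ψ

/-- specialisation to residue-class slopes. -/
theorem residueSlope_of_linear {m Φ : ℕ} (h : LinearInstanceBound m Φ) : ResidueSlopeInstanceBound m Φ :=
  fun ψ _ => fixedSlope_of_linear h ψ

/-- monotonicity in the bound. -/
theorem LinearInstanceBound.mono {m Φ Φ' : ℕ} (h : LinearInstanceBound m Φ) (hle : Φ ≤ Φ') :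
    LinearInstanceBound m Φ' :=
  fun ψ α P N θ' τ hθ hτ hP hopt => le_trans (h ψ α P N θ' τ hθ hτ hP hopt) hle

/-- monotonicity in the bound. -/
theorem FixedSlopeInstanceBound.mono {m Φ Φ' : ℕ} {ψ : ℤ → ℤ} (h : FixedSlopeInstanceBound m ψ Φ) (hle : Φ ≤ Φ') :
    FixedSlopeInstanceBound m ψ Φ' :=
  fun α P N θ' τ hθ hτ hP hopt => le_trans (h α P N θ' τ hθ hτ hP hopt) hle

/-- **Non-vacuity**: the one-member family `id` with only the displacement `0` admissible satisfies every hypothesis, so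
`LinearInstanceBound m Φ` forces `1 ≤ Φ` (in particular `LinearInstanceBound m 0` is false for every `m`). [folklore] -/
theorem LinearInstanceBound.one_le {m Φ : ℕ} (h : LinearInstanceBound m Φ) : 1 ≤ Φ := by
  refine h (fun _ => 0) (fun _ => 0) (fun δ => δ = 0) 0 (fun _ => 0) (fun _ => 1) (fun a b hab => ?_)
    (fun a b _ => Fin.ext (by have := a.isLt; have := b.isLt; omega)) (fun k b => by simp) (fun k σ' hσ' hP => ?_)
  · exfalso
    have h' := Fin.lt_def.mp hab
    have := a.isLt; have := b.isLt
    omega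
  · exfalso
    apply hσ'
    ext b
    have hb := hP b
    simp only [Equiv.Perm.coe_one, id_eq]
    omega

/-- Sanity row `m = 0`: `Perm (Fin 0)` has one element, so every family has one member: `Φ_Toep(0) = 1`. [folklore] -/
theorem linearInstanceBound_zero_iff (Φ : ℕ) : LinearInstanceBound 0 Φ ↔ 1 ≤ Φ := by
  refine ⟨LinearInstanceBound.one_le, fun hΦ ψ α P N θ' τ _ hτ _ _ => ?_⟩
  have h := Fintype.card_le_of_injective τ hτ
  simp only [Fintype.card_fin, Fintype.card_perm, Nat.factorial_zero] at h
  omega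

/-- Sanity row `m = 1`: one permutation, `Φ_Toep(1) = 1`. [folklore] -/
theorem linearInstanceBound_one_iff (Φ : ℕ) : LinearInstanceBound 1 Φ ↔ 1 ≤ Φ := by
  refine ⟨LinearInstanceBound.one_le, fun hΦ ψ α P N θ' τ _ hτ _ _ => ?_⟩
  have h := Fintype.card_le_of_injective τ hτ
  simp only [Fintype.card_fin, Fintype.card_perm, Nat.factorial_one] at h
  omega

/-! ## Conjecture T and its sharpened / weakened forms (all OPEN; `Prop`s, nothing asserted) -/

/-- **CONJECTURE T** (linear form): `Φ_Toep(m) = O(m)`.  OPEN (cell pub-symmetroid, 2026-08-26); located lower bounds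
`8, 13, 18, 23` at `m = 4..7`, kernel floors `18 / 23 / 26 / 28` at `m ≥ 6 / 7 / 8 / 9`; any constant is `≥ 4`
(`four_le_of_conjectureTLinear`). [open question of the cell pub-symmetroid; no citation exists] -/
def ConjectureTLinear : Prop := ∃ C : ℕ, ∀ m : ℕ, LinearInstanceBound m (C * m)

/-- **CONJECTURE T** (polynomial fallback — all that `toeplitz_chain_le_of_linearBound` needs for a polynomial `TropicalB` on
the Toeplitz sector, `toeplitzSector_of_conjectureTPoly`).  OPEN. [open question of the cell pub-symmetroid; no citation exists] -/
def ConjectureTPoly : Prop := ∃ C : ℕ, ∀ m : ℕ, LinearInstanceBound m ((m + 1) ^ C)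

/-- **CONJECTURE T♯** (located constant, method memo CONJT-METHOD-g22): `Φ_Toep(m) ≤ 5m` (hill-climb values `5m − 12` at
`m = 4..7`).  OPEN; the cheapest falsifier is ONE linear instance with `5m + 1` unique optima. [open question of the cell pub-symmetroid; no citation exists] -/
def ConjectureTSharp : Prop := ∀ m : ℕ, LinearInstanceBound m (5 * m)

/-- **CONJECTURE Q** (quadratic-slope law): for the ONE fixed slope direction `ψ = δ²`, intercepts and admissible set free,
the count is `O(m)` (located `6, 8, 12, 15, 18` at `m = 4..8`; term count `Θ(m³)`, so only an `o(m³)` bound has content).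
OPEN. [open question of the cell pub-symmetroid; no citation exists] -/
def ConjectureQ : Prop := ∃ C : ℕ, ∀ m : ℕ, FixedSlopeInstanceBound m (fun δ => δ ^ 2) (C * m)

/-- **CONJECTURE R** (residue-slope law): wrap-blind slopes, free intercepts ⇒ `O(m)` (located `11, 15` at `m = 5, 6`).
OPEN. [open question of the cell pub-symmetroid; no citation exists] -/
def ConjectureR : Prop := ∃ C : ℕ, ∀ m : ℕ, ResidueSlopeInstanceBound m (C * m)

/-- A permutation is **FRAMELESS** when no proper non-empty window `[a, a+ℓ)` (`1 ≤ ℓ < m`) is mapped into itself (the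
members of a chain untouched by the frame recursion `toeplitz_opt_window` / `toeplitz_window_chain_le`). -/
def Frameless {m : ℕ} (τ : Equiv.Perm (Fin m)) : Prop :=
  ∀ a ℓ : ℕ, 1 ≤ ℓ → ℓ < m → a + ℓ ≤ m →
    ∃ b : Fin m, a ≤ (b : ℕ) ∧ (b : ℕ) < a + ℓ ∧ ¬ (a ≤ (τ b : ℕ) ∧ (τ b : ℕ) < a + ℓ)

/-- **«`Φ⁰_Toep(m) ≤ Φ`»**: the count of `LinearInstanceBound` restricted to families ALL of whose members are frameless — the
conjecture's hard core in the frame picture (method memo §3.4 (e): frameless members are the majority of every certified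
extremal chain, `11/18, 14/23, 18/26, 14/28` at `m = 6..9`). -/
def FramelessInstanceBound (m Φ : ℕ) : Prop :=
  ∀ (ψ α : ℤ → ℤ) (P : ℤ → Prop) (N : ℕ) (θ' : Fin (N + 1) → ℤ) (τ : Fin (N + 1) → Equiv.Perm (Fin m)),
    StrictMono θ' → Function.Injective τ → (∀ k, Frameless (τ k)) → (∀ k b, P ((τ k b : ℤ) - (b : ℤ))) →
    (∀ k (σ' : Equiv.Perm (Fin m)), σ' ≠ τ k → (∀ b, P ((σ' b : ℤ) - (b : ℤ))) →
      ∑ b, (θ' k * ψ ((σ' b : ℤ) - (b : ℤ)) + α ((σ' b : ℤ) - (b : ℤ))) <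
        ∑ b, (θ' k * ψ ((τ k b : ℤ) - (b : ℤ)) + α ((τ k b : ℤ) - (b : ℤ)))) →
    N + 1 ≤ Φ

/-- **CONJECTURE T⁰** (frameless core, linear form; located `≈ 1.8·m`).  OPEN. [open question of the cell pub-symmetroid; no citation exists] -/
def ConjectureT0 : Prop := ∃ C : ℕ, ∀ m : ℕ, FramelessInstanceBound m (C * m)

/-- the frameless sub-count is below the full count. -/
theorem framelessBound_of_linear {m Φ : ℕ} (h : LinearInstanceBound m Φ) : FramelessInstanceBound m Φ :=
  fun ψ α P N θ' τ hθ hτ _ hP hopt => h ψ α P N θ' τ hθ hτ hP hopt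

/-- `T ⇒ T⁰`. -/
theorem conjectureT0_of_TLinear (h : ConjectureTLinear) : ConjectureT0 := by
  obtain ⟨C, hC⟩ := h
  exact ⟨C, fun m => framelessBound_of_linear (hC m)⟩

/-- `T♯ ⇒ T`. -/
theorem conjectureTLinear_of_sharp (h : ConjectureTSharp) : ConjectureTLinear := ⟨5, h⟩

/-- `T ⇒ T_poly`. -/
theorem conjectureTPoly_of_linear (h : ConjectureTLinear) : ConjectureTPoly := by
  obtain ⟨C, hC⟩ := h
  refine ⟨C + 1, fun m => (hC m).mono ?_⟩
  rcases Nat.eq_zero_or_pos m with hm | hm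
  · subst hm; simp
  · have h1 : C ≤ (m + 1) ^ C :=
      calc C ≤ 2 ^ C := Nat.lt_two_pow_self.le
        _ ≤ (m + 1) ^ C := Nat.pow_le_pow_left (by omega) C
    calc C * m ≤ (m + 1) ^ C * (m + 1) := Nat.mul_le_mul h1 (Nat.le_succ m)
      _ = (m + 1) ^ (C + 1) := by ring

/-- `T ⇒ Q`. -/
theorem conjectureQ_of_TLinear (h : ConjectureTLinear) : ConjectureQ := by
  obtain ⟨C, hC⟩ := h
  exact ⟨C, fun m => fixedSlope_of_linear (hC m) _⟩

/-- `T ⇒ R`. -/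
theorem conjectureR_of_TLinear (h : ConjectureTLinear) : ConjectureR := by
  obtain ⟨C, hC⟩ := h
  exact ⟨C, fun m => residueSlope_of_linear (hC m)⟩

/-! ## Kernel facts by name -/

/-- **MONOTONICITY IN THE SIZE** as a named statement: a bound at size `m + 1` is a bound at size `m` (`Φ_Toep(m) ≤ Φ_Toep(m+1)`). -/
def CornerPinMonotone : Prop :=
  ∀ (m Φ : ℕ), LinearInstanceBound (m + 1) Φ → LinearInstanceBound m Φ

/-- **FRAME EMBEDDING** as a named statement: a bound at size `m + 2` is a bound at size `m` (`Φ_Toep(m) ≤ Φ_Toep(m+2)`; the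
lower direction of the transposition-frame recursion `toeplitz_transpositionFrame_chain_le`). -/
def FrameEmbedding : Prop :=
  ∀ (m Φ : ℕ), LinearInstanceBound (m + 2) Φ → LinearInstanceBound m Φ

/-- **`CornerPinMonotone` HOLDS** (kernel: the corner pin `toeplitz_linearBound_of_succ`, `…ToeplitzCornerPin`). -/
theorem cornerPinMonotone : CornerPinMonotone :=
  fun _m Φ h ψ α P N θ' τ hθ hτ hP hopt => toeplitz_linearBound_of_succ Φ h ψ α P N θ' τ hθ hτ hP hopt

/-- `FrameEmbedding` from the corner pin, twice. -/
theorem frameEmbedding_of_cornerPin (h : CornerPinMonotone) : FrameEmbedding :=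
  fun m Φ hΦ => h m Φ (h (m + 1) Φ hΦ)

/-- **`FrameEmbedding` HOLDS** (kernel). -/
theorem frameEmbedding : FrameEmbedding := frameEmbedding_of_cornerPin cornerPinMonotone

/-- **`Φ_Toep` is non-decreasing**: a bound at size `m'` is a bound at every size `m ≤ m'` (`toeplitz_linearBound_of_le`). -/
theorem LinearInstanceBound.of_le {m m' Φ : ℕ} (hmm' : m ≤ m') (h : LinearInstanceBound m' Φ) :
    LinearInstanceBound m Φ :=
  fun ψ α P N θ' τ hθ hτ hP hopt => toeplitz_linearBound_of_le hmm' Φ h ψ α P N θ' τ hθ hτ hP hopt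

/-- **Kernel floor `Φ_Toep(m) ≥ 18` for `m ≥ 6`** (certificate `toeplitz_linearBound_six_ge` + monotonicity). -/
theorem le_of_linearInstanceBound_six {m Φ : ℕ} (hm : 6 ≤ m) (h : LinearInstanceBound m Φ) : 18 ≤ Φ :=
  toeplitz_linearBound_ge_of_six_le hm Φ h

/-- **Kernel floor `Φ_Toep(m) ≥ 23` for `m ≥ 7`** (certificate `toeplitz_linearBound_seven_ge` + monotonicity). -/
theorem le_of_linearInstanceBound_seven {m Φ : ℕ} (hm : 7 ≤ m) (h : LinearInstanceBound m Φ) : 23 ≤ Φ :=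
  toeplitz_linearBound_ge_of_seven_le hm Φ h

/-- **Kernel floor `Φ_Toep(m) ≥ 26` for `m ≥ 8`** (certificate `toeplitz_linearBound_eight_ge` + monotonicity). -/
theorem le_of_linearInstanceBound_eight {m Φ : ℕ} (hm : 8 ≤ m) (h : LinearInstanceBound m Φ) : 26 ≤ Φ :=
  toeplitz_linearBound_ge_of_eight_le hm Φ h

/-- **Kernel floor `Φ_Toep(m) ≥ 28` for `m ≥ 9`** (certificate `toeplitz_linearBound_nine_ge` + monotonicity). -/
theorem le_of_linearInstanceBound_nine {m Φ : ℕ} (hm : 9 ≤ m) (h : LinearInstanceBound m Φ) : 28 ≤ Φ :=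
  toeplitz_linearBound_ge_of_nine_le hm Φ h

/-- the `m = 9` certificate as a negation: `Φ_Toep(9) > 27`. -/
theorem not_linearInstanceBound_nine_27 : ¬ LinearInstanceBound 9 27 := fun h =>
  absurd (le_of_linearInstanceBound_nine le_rfl h) (by norm_num)

/-- **The linear form with constant `3` is FALSE** (`not_toeplitz_linearBound_three_mul`: `28 > 27` at `m = 9`). -/
theorem not_conjectureTLinear_three : ¬ (∀ m : ℕ, LinearInstanceBound m (3 * m)) := fun h =>
  not_linearInstanceBound_nine_27 (h 9)

/-- **Any constant in Conjecture T is at least `4`** (same datum). -/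
theorem four_le_of_conjectureTLinear (C : ℕ) (h : ∀ m : ℕ, LinearInstanceBound m (C * m)) : 4 ≤ C := by
  have h9 := le_of_linearInstanceBound_nine le_rfl (h 9)
  omega

/-- **CURRENCY CHECK**: `LinearInstanceBound m Φ` is literally the hypothesis of the tree's Toeplitz reduction
`toeplitz_chain_le_of_linearBound` (p429098) — every sign-alternating dominant chain of a Toeplitz design of format `(m, K)`
then has `n + 1 ≤ (2(2m+1)K² + 1)·Φ` terms. -/
theorem chain_le_of_linearInstanceBound {m K : ℕ} (Φ : ℕ) (hΦ : LinearInstanceBound m Φ)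
    (d : Fin K → ℕ) (f g : ℤ → Fin K → ℤ) (n : ℕ) (θ : Fin (n + 1) → ℤ)
    (p : Fin (n + 1) → Equiv.Perm (Fin m) × (Fin m → Fin K)) (hθ : StrictMono θ)
    (hdom : ∀ k, IsDominant d (fun a b l => f ((a : ℤ) - b) l) (fun a b l => g ((a : ℤ) - b) l) (θ k) (p k))
    (halt : ∀ k : Fin n, termSign (fun a b l => g ((a : ℤ) - b) l) (p k.castSucc) *
      termSign (fun a b l => g ((a : ℤ) - b) l) (p k.succ) < 0) :
    n + 1 ≤ (2 * ((2 * m + 1) * K * K) + 1) * Φ :=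
  toeplitz_chain_le_of_linearBound Φ hΦ d f g n θ p hθ hdom halt

/-- **THE LANE'S CONDITIONAL PAYOFF, by name** (`toeplitz_sector_kPlusLogSq_of_polyBound`): polynomial Conjecture T ⇒ every
sign-alternating dominant chain of every TOEPLITZ design of format `(m, K)` obeys the `K + log² m` law — there is `C` with
`n ≤ 2^(C (K + ⌊log₂ m⌋²))`, namely `C = 9c + 13` for the exponent `c` of `ConjectureTPoly`. -/
theorem toeplitzSector_of_conjectureTPoly (hT : ConjectureTPoly) :
    ∃ C : ℕ, ∀ (m K : ℕ) (d : Fin K → ℕ) (f g : ℤ → Fin K → ℤ) (n : ℕ) (θ : Fin (n + 1) → ℤ)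
      (p : Fin (n + 1) → Equiv.Perm (Fin m) × (Fin m → Fin K)), StrictMono θ →
      (∀ k, IsDominant d (fun a b l => f ((a : ℤ) - b) l) (fun a b l => g ((a : ℤ) - b) l) (θ k) (p k)) →
      (∀ k : Fin n, termSign (fun a b l => g ((a : ℤ) - b) l) (p k.castSucc) *
        termSign (fun a b l => g ((a : ℤ) - b) l) (p k.succ) < 0) →
      n ≤ 2 ^ (C * (K + Nat.log 2 m ^ 2)) := by
  obtain ⟨c, hc⟩ := hT
  exact ⟨9 * c + 13, fun m K d f g n θ p hθ hdom halt =>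
    toeplitz_sector_kPlusLogSq_of_polyBound c (fun m => hc m) d f g n θ p hθ hdom halt⟩

end Summit.ValiantsHypothesis.ValiantsHypothesis.Theorems.KPlusLogSqLaw.Toeplitz
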